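import Summits.HodgeConjecture.CorCM.IrreducibleOddWeightsCoreTower
import Summits.HodgeConjecture.CorCM.IrreducibleOddWeightsCanonicalPivotFamilies
import HarnessLib

/-!
# Core tower, V: FAMILIES — the relations among the matrix coefficients of `∏_i A_i` are absorbed along a tower of
# per-slot orbit partitions (abstract `G`-sets)

COR-CM (cell `pub-hodgecm2`, binder seat `b16` gen 67, count-neutral claim CORE TOWER, file A5 — abstract `G`-set
level; theorems only, no definition, no named fact, no `sorry`).  NEW as stated, hence under `Summits/`.  HONEST
FRAMING: finite-dimensional linear algebra about the Kubota–Dodson rank of a finite family of CM types (`dim Hg(∏_i A_i)`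
versus `Σ_i dim Hg(A_i)` for abelian varieties with complex multiplication); `HC_CM` is neither used nor asserted.

SETTING (gen 64 R5 `IrreducibleOddWeightsRightIdealsPivotFamilies`, gen 65 C4 `IrreducibleOddWeightsCanonicalPivotFamilies`).
A group `G` acts on finite slots `E_i`, `i ∈ I`; types `Φ_i`, `u_i = 2·𝟙_{Φ_i} − 1`, matrix-coefficient spaces
`MC_i ≤ ℚ^G`; the FAMILY DEFECT is `Σ_i dim Hg(A_i) − dim Hg(∏_i A_i) = Σ_i dim MC_i − dim Σ_i MC_i`, the dimension of the
space of RELATIONS `Σ_i c_i = 0`, `c_i ∈ MC_i` (R5).  For subgroups `N_j ≤ G` write `F_j^{N_j} = span{ g ↦ Σ_{x ∈ N_j·x₀}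
u_j(g·x) }` (orbit sums).  Say `(N_j)_j` is ABSORBED if every component `c_j` of every relation lies in `F_j^{N_j}`; then
(R5's transfer) `Σ_i dim Hg(A_i) − dim Hg(∏ A_i) = Σ_j dim F_j − dim Σ_j F_j`.  C4 proved that `N_j = ⋂_{i≠j} PW_i` is
absorbed and stopped.  THIS FILE iterates, as A1 (`IrreducibleOddWeightsCoreTower`) did for pairs:

* §1 One slot, subgroup form: movers preserve orbit sums of a NORMAL subgroup (`orbit_sum_antiVec_mul_eq_of_movers`,
  `apply_mul_eq_of_mem_span_orbitSum`), averaging (`mem_span_orbitSum_of_forall_apply_mul_eq`), `F^{⊥} = MC`, and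
  vanishing of `F^N` on `ρ`-stable orbits (`span_orbitSum_eq_bot_of_orbit_rho_stable`).
* §2 **THE FAMILY ABSORPTION STEP** (`forall_rel_mem_span_orbitSum_of_absorbed`): if `(N_j)` is absorbed (all `N_j` normal)
  and every `N'_j` lies in the subgroup generated by the MOVERS of slot `j` (elements moving each point of `E_j` inside its
  `N_j`-orbit) and the JOINT MOVERS of the other slots (moving, for every `i ≠ j`, each point of `E_i` inside its
  `N_i`-orbit), then `(N'_j)` is absorbed: `c_j ∈ F_j^{N_j}` is invariant under the former, `c_j = −Σ_{i≠j} c_i` under the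
  latter.  BASE `(⊥)_j` (`forall_rel_mem_span_orbitSum_bot`); one step from `⊥` is C4's hypothesis
  `N_j ≤ ⟨PW_j ∪ ⋂_{i≠j} PW_i⟩`; every further step is new (for `Aut(ℂ)`: replace each Galois closure by the Galois
  closure of its trace, file A6).
* §3 On an absorbed level: the exact family defect (`sum_typeRank_add_one_add_finrank_iSup_eq_of_absorbed`), additivity
  iff the `F_j^{N_j}` are independent, and the type-free criterion **all but one slot with `ρ`-stable `N_j`-orbits ⟹
  `Hg(∏_i A_i) = ∏_i Hg(A_i)` for every family of CM types** (`typeRank_sigmaType_add_card_eq_of_absorbed_of_forall_ne_rho_stable`).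

## References

* [Gordon1999HodgeAVSurvey] B. B. Gordon, *A survey of the Hodge conjecture for abelian varieties*, §3 Theorem (Imai,
  Murty) with proof, 7.5–7.7.
* [Deligne1982HodgeCycles] P. Deligne, *Hodge cycles on abelian varieties*, LNM 900 (1982), I.5 (p. 62), I Ex. 3.7.
* [Serre1977] J.-P. Serre, *Linear Representations of Finite Groups*, GTM 42, §3.3, §7 Ex. 7.2.
* [Shimura1998] G. Shimura, *Abelian Varieties with Complex Multiplication and Modular Functions*, §8.3, §18.1.
-/

set_option autoImplicit false

noncomputable section

open scoped BigOperators Classical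

universe u v w
namespace Summit.HodgeConjecture.CorCM.IrrOdd

open Literature.NumberTheory.ComplexMultiplication

variable {G : Type w} [Group G]

/-! ### §1 One slot, subgroup form -/

section OneSlot

variable {X : Type v} [MulAction G X] [Fintype X]

/-- `F^N ≤ MC`. [cite: Gordon1999HodgeAVSurvey, §3 Theorem (proof)] -/
theorem span_orbitSum_le_span_coeff (Φ : Set X) (N : Subgroup G) :
    Submodule.span ℚ (Set.range fun x₀ : X => fun g : G =>
        ∑ x ∈ Finset.univ.filter (fun x : X => ∃ n ∈ N, n • x₀ = x), antiVec Φ g x) ≤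
      Submodule.span ℚ (Set.range fun x : X => fun g : G => antiVec Φ g x) := by
  rw [Submodule.span_le]
  rintro _ ⟨x₀, rfl⟩
  exact sum_coeff_mem_span_coeff Φ _

/-- `F^{⊥} = MC`: the orbits of the trivial subgroup are points. [cite: Serre1977, §7 Ex. 7.2] -/
theorem span_orbitSum_bot_eq_span_coeff (Φ : Set X) :
    Submodule.span ℚ (Set.range fun x₀ : X => fun g : G =>
        ∑ x ∈ Finset.univ.filter (fun x : X => ∃ n ∈ (⊥ : Subgroup G), n • x₀ = x), antiVec Φ g x) =
      Submodule.span ℚ (Set.range fun x : X => fun g : G => antiVec Φ g x) := by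
  have e : (fun x₀ : X => fun g : G =>
      ∑ x ∈ Finset.univ.filter (fun x : X => ∃ n ∈ (⊥ : Subgroup G), n • x₀ = x), antiVec Φ g x) =
        fun x₀ : X => fun g : G => antiVec Φ g x₀ := by
    funext x₀ g
    have hfilter : Finset.univ.filter (fun x : X => ∃ n ∈ (⊥ : Subgroup G), n • x₀ = x) = {x₀} := by
      ext x
      simp only [Finset.mem_filter, Finset.mem_univ, true_and, Finset.mem_singleton, Subgroup.mem_bot,
        exists_eq_left, one_smul]
      exact eq_comm
    rw [hfilter, Finset.sum_singleton]
  rw [e]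

/-- **Movers preserve the orbit sums of a NORMAL subgroup**: if `m` moves every point of `X` inside its `N`-orbit then
`Σ_{x ∈ N·x₀} u(gm·x) = Σ_{x ∈ N·x₀} u(g·x)`. [cite: Serre1977, §3.3 and §7 Ex. 7.2] -/
theorem orbit_sum_antiVec_mul_eq_of_movers (Φ : Set X) (N : Subgroup G) (hN : N.Normal) {m : G}
    (hm : ∀ x : X, ∃ n ∈ N, n • x = m • x) (g : G) (x₀ : X) :
    ∑ x ∈ Finset.univ.filter (fun x : X => ∃ n ∈ N, n • x₀ = x), antiVec Φ (g * m) x =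
      ∑ x ∈ Finset.univ.filter (fun x : X => ∃ n ∈ N, n • x₀ = x), antiVec Φ g x := by
  simp only [antiVec_mul_apply]
  refine Finset.sum_nbij' (fun x => m • x) (fun x => m⁻¹ • x) ?_ ?_ ?_ ?_ ?_
  · intro x hx
    simp only [Finset.mem_filter, Finset.mem_univ, true_and] at hx ⊢
    obtain ⟨n, hn, rfl⟩ := hx
    obtain ⟨n', hn', hn'x⟩ := hm x₀
    refine ⟨m * n * m⁻¹ * n', N.mul_mem (hN.conj_mem n hn m) hn', ?_⟩
    rw [mul_smul, mul_smul, mul_smul, hn'x, inv_smul_smul]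
  · intro x hx
    simp only [Finset.mem_filter, Finset.mem_univ, true_and] at hx ⊢
    obtain ⟨n, hn, rfl⟩ := hx
    obtain ⟨n'', hn'', h''⟩ := hm (m⁻¹ • n • x₀)
    rw [smul_inv_smul] at h''
    refine ⟨n''⁻¹ * n, N.mul_mem (N.inv_mem hn'') hn, ?_⟩
    rw [mul_smul]
    exact (eq_inv_smul_iff.2 h'').symm
  · exact fun x _ => inv_smul_smul m x
  · exact fun x _ => smul_inv_smul m x
  · exact fun x _ => rfl

/-- Every element of `F^N` (`N` normal) is right-invariant under the movers of the `N`-orbits. [cite: Serre1977, §3.3] -/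
theorem apply_mul_eq_of_mem_span_orbitSum (Φ : Set X) (N : Subgroup G) (hN : N.Normal) {c : G → ℚ}
    (hc : c ∈ Submodule.span ℚ (Set.range fun x₀ : X => fun g : G =>
        ∑ x ∈ Finset.univ.filter (fun x : X => ∃ n ∈ N, n • x₀ = x), antiVec Φ g x))
    {m : G} (hm : ∀ x : X, ∃ n ∈ N, n • x = m • x) (g : G) : c (g * m) = c g := by
  induction hc using Submodule.span_induction with
  | mem _ hx =>
    obtain ⟨x₀, rfl⟩ := hx
    exact orbit_sum_antiVec_mul_eq_of_movers Φ N hN hm g x₀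
  | zero => rfl
  | add _ _ _ _ h₁ h₂ => simp only [Pi.add_apply, h₁, h₂]
  | smul a _ _ h₁ => simp only [Pi.smul_apply, h₁]

/-- **Averaging, subgroup form**: an element of `MC` right-invariant under `N'` lies in `F^{N'}`.
[cite: Serre1977, §3.3] [cite: Gordon1999HodgeAVSurvey, §3 Theorem (proof)] -/
theorem mem_span_orbitSum_of_forall_apply_mul_eq (Φ : Set X) (N' : Subgroup G) {c : G → ℚ}
    (hc : c ∈ Submodule.span ℚ (Set.range fun x : X => fun g : G => antiVec Φ g x))
    (hinv : ∀ n ∈ N', ∀ g : G, c (g * n) = c g) :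
    c ∈ Submodule.span ℚ (Set.range fun x₀ : X => fun g : G =>
        ∑ x ∈ Finset.univ.filter (fun x : X => ∃ n ∈ N', n • x₀ = x), antiVec Φ g x) := by
  have h := mem_span_fibreSum_of_forall_apply_mul_eq Φ (fun x : X => MulAction.orbit N' x) N'
    (fun x x' hxx' => exists_smul_eq_of_orbit_eq N' hxx') hc hinv
  rw [span_fibreSum_eq_span_fibreSum_apply Φ (fun x : X => MulAction.orbit N' x)] at h
  simp only [filter_orbit_eq_eq_filter_exists_smul] at h
  exact h

/-- **Vanishing**: if every `N`-orbit on `X` is `ρ`-stable then `F^N = 0` (`x ↦ ρ·x` is an involution of each orbit on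
which every translate `u_g` is odd; no normality needed). [cite: Shimura1998, §8.3 and §18.1] -/
theorem span_orbitSum_eq_bot_of_orbit_rho_stable {ρ : G} {Φ : Set X} (h : IsCMTypeWith ρ Φ) (N : Subgroup G)
    (hρ : ∀ x₀ : X, ∃ n ∈ N, n • x₀ = ρ • x₀) :
    Submodule.span ℚ (Set.range fun x₀ : X => fun g : G =>
        ∑ x ∈ Finset.univ.filter (fun x : X => ∃ n ∈ N, n • x₀ = x), antiVec Φ g x) =
      (⊥ : Submodule ℚ (G → ℚ)) := by
  rw [Submodule.span_eq_bot]
  rintro _ ⟨x₀, rfl⟩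
  funext g
  obtain ⟨n₀, hn₀, hn₀x⟩ := hρ x₀
  refine Finset.sum_involution (fun x _ => ρ • x) (fun x _ => ?_) (fun x _ _ => h.rho_smul_ne x)
    (fun x hx => ?_) (fun x _ => h.invol x)
  · simp only [antiVec, h.translateInd_rho_smul]
    ring
  · simp only [Finset.mem_filter, Finset.mem_univ, true_and] at hx ⊢
    obtain ⟨n, hn, rfl⟩ := hx
    exact ⟨n * n₀, N.mul_mem hn hn₀, by rw [mul_smul, hn₀x, h.comm]⟩

end OneSlot

/-! ### §2 The family absorption step -/

section Family

variable {I : Type u} {E : I → Type v} [∀ i, MulAction G (E i)] [Fintype I] [∀ i, Fintype (E i)]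

omit [Fintype I] in
/-- **THE BASE: `(⊥)_j` is absorbed** — the components of a relation lie in `MC_j = F_j^{⊥}`.
[cite: Gordon1999HodgeAVSurvey, §3 Theorem (proof)] -/
theorem forall_rel_mem_span_orbitSum_bot (Φ : ∀ i, Set (E i)) (c : I → G → ℚ)
    (hc : ∀ i, c i ∈ Submodule.span ℚ (Set.range fun x : E i => fun g : G => antiVec (Φ i) g x)) (j : I) :
    c j ∈ Submodule.span ℚ (Set.range fun x₀ : E j => fun g : G =>
      ∑ x ∈ Finset.univ.filter (fun x : E j => ∃ n ∈ (⊥ : Subgroup G), n • x₀ = x), antiVec (Φ j) g x) := by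
  rw [span_orbitSum_bot_eq_span_coeff]
  exact hc j

/-- **THE FAMILY ABSORPTION STEP.**  Let `(N_j)_j` be normal subgroups such that every relation `Σ_i c_i = 0`, `c_i ∈ MC_i`,
has `c_j ∈ F_j^{N_j}` for all `j`; let `N'_j` lie in the subgroup generated by the movers of the `N_j`-orbits on `E_j`
together with the joint movers of the `N_i`-orbits on all `E_i`, `i ≠ j`.  Then every relation has `c_j ∈ F_j^{N'_j}`:
`c_j` is right-invariant under the movers of slot `j` (§1) and, being `−Σ_{i≠j} c_i`, under the joint movers of the
other slots; averaging concludes.  One step from `(⊥)_j` is C4/R5's hypothesis `N_j ≤ ⟨PW_j ∪ ⋂_{i≠j} PW_i⟩`.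
[cite: Gordon1999HodgeAVSurvey, §3 Theorem (proof)] [cite: Serre1977, §3.3] -/
theorem forall_rel_mem_span_orbitSum_of_absorbed (Φ : ∀ i, Set (E i)) (N N' : I → Subgroup G)
    (hN : ∀ j, (N j).Normal)
    (habs : ∀ c : I → G → ℚ,
      (∀ i, c i ∈ Submodule.span ℚ (Set.range fun x : E i => fun g : G => antiVec (Φ i) g x)) →
        ∑ i, c i = 0 → ∀ j, c j ∈ Submodule.span ℚ (Set.range fun x₀ : E j => fun g : G =>
          ∑ x ∈ Finset.univ.filter (fun x : E j => ∃ n ∈ N j, n • x₀ = x), antiVec (Φ j) g x))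
    (hN' : ∀ j : I, (N' j : Set G) ⊆ Subgroup.closure
      ({m : G | ∀ x : E j, ∃ n ∈ N j, n • x = m • x} ∪
        {m : G | ∀ i, i ≠ j → ∀ x : E i, ∃ n ∈ N i, n • x = m • x}))
    (c : I → G → ℚ) (hc : ∀ i, c i ∈ Submodule.span ℚ (Set.range fun x : E i => fun g : G => antiVec (Φ i) g x))
    (hsum : ∑ i, c i = 0) (j : I) :
    c j ∈ Submodule.span ℚ (Set.range fun x₀ : E j => fun g : G =>
      ∑ x ∈ Finset.univ.filter (fun x : E j => ∃ n ∈ N' j, n • x₀ = x), antiVec (Φ j) g x) := by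
  have hF := habs c hc hsum
  -- `c_j = -Σ_{i ≠ j} c_i`, pointwise
  have hcj : ∀ g : G, c j g = -∑ i ∈ Finset.univ.erase j, c i g := fun g => by
    have h0 := congrFun hsum g
    rw [Finset.sum_apply, ← Finset.add_sum_erase _ _ (Finset.mem_univ j), Pi.zero_apply] at h0
    linarith
  have hS : ∀ m ∈ ({m : G | ∀ x : E j, ∃ n ∈ N j, n • x = m • x} ∪
      {m : G | ∀ i, i ≠ j → ∀ x : E i, ∃ n ∈ N i, n • x = m • x}), ∀ g : G, c j (g * m) = c j g := by
    rintro m (hm | hm) g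
    · exact apply_mul_eq_of_mem_span_orbitSum (Φ j) (N j) (hN j) (hF j) hm g
    · rw [hcj (g * m), hcj g]
      congr 1
      exact Finset.sum_congr rfl fun i hi =>
        apply_mul_eq_of_mem_span_orbitSum (Φ i) (N i) (hN i) (hF i) (hm i (Finset.ne_of_mem_erase hi)) g
  exact mem_span_orbitSum_of_forall_apply_mul_eq (Φ j) (N' j) (hc j)
    fun n hn g => forall_apply_mul_eq_of_mem_closure hS (hN' j hn) g

end Family

/-! ### §3 On an absorbed level: exact family defect, independence, type-free criterion -/

section Absorbed

variable {I : Type u} {E : I → Type v} [∀ i, MulAction G (E i)] [Fintype I] [∀ i, Fintype (E i)]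
  [∀ i, Nonempty (E i)] [Nonempty I]

/-- **THE EXACT FAMILY DEFECT ON AN ABSORBED LEVEL**: `Σ_i rank Φ_i + 1 + dim ⨆_j F_j^{N_j} = rank(Σ) + |I| + Σ_j dim F_j^{N_j}`,
i.e. **`Σ_i dim Hg(A_i) − dim Hg(∏_i A_i) = Σ_j dim F_j − dim Σ_j F_j`** — whenever `(N_j)_j` is absorbed (§2).
[cite: Deligne1982HodgeCycles, I.5 (p. 62)] [cite: Gordon1999HodgeAVSurvey, §3 Theorem and 7.7] -/
theorem sum_typeRank_add_one_add_finrank_iSup_eq_of_absorbed {ρ : G} {Φ : ∀ i, Set (E i)}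
    (h : ∀ i, IsCMTypeWith ρ (Φ i)) (N : I → Subgroup G)
    (habs : ∀ c : I → G → ℚ,
      (∀ i, c i ∈ Submodule.span ℚ (Set.range fun x : E i => fun g : G => antiVec (Φ i) g x)) →
        ∑ i, c i = 0 → ∀ j, c j ∈ Submodule.span ℚ (Set.range fun x₀ : E j => fun g : G =>
          ∑ x ∈ Finset.univ.filter (fun x : E j => ∃ n ∈ N j, n • x₀ = x), antiVec (Φ j) g x)) :
    (∑ i, typeRank G (Φ i)) + 1 + Module.finrank ℚ (⨆ j, Submodule.span ℚ (Set.range fun x₀ : E j => fun g : G =>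
          ∑ x ∈ Finset.univ.filter (fun x : E j => ∃ n ∈ N j, n • x₀ = x), antiVec (Φ j) g x) :
            Submodule ℚ (G → ℚ)) =
      typeRank G (sigmaType Φ) + Fintype.card I +
        ∑ j, Module.finrank ℚ (Submodule.span ℚ (Set.range fun x₀ : E j => fun g : G =>
          ∑ x ∈ Finset.univ.filter (fun x : E j => ∃ n ∈ N j, n • x₀ = x), antiVec (Φ j) g x)) := by
  haveI := fun i => finite_span_coeff (G := G) (Φ i)
  have h1 := typeRank_sigmaType_add_card_add_sum_finrank_eq h
  have h2 := sum_finrank_add_finrank_iSup_eq_of_forall_rel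
    (fun j => Submodule.span ℚ (Set.range fun x₀ : E j => fun g : G =>
      ∑ x ∈ Finset.univ.filter (fun x : E j => ∃ n ∈ N j, n • x₀ = x), antiVec (Φ j) g x))
    (fun i => Submodule.span ℚ (Set.range fun x : E i => fun g : G => antiVec (Φ i) g x))
    (fun j => span_orbitSum_le_span_coeff (Φ j) (N j)) habs
  omega

/-- **`Hg(∏_i A_i) = ∏_i Hg(A_i)` IFF THE `F_j^{N_j}` ARE INDEPENDENT**, on any absorbed level.
[cite: Gordon1999HodgeAVSurvey, §3 Theorem and 7.5–7.7] -/
theorem typeRank_sigmaType_add_card_eq_iff_iSupIndep_of_absorbed {ρ : G} {Φ : ∀ i, Set (E i)}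
    (h : ∀ i, IsCMTypeWith ρ (Φ i)) (N : I → Subgroup G)
    (habs : ∀ c : I → G → ℚ,
      (∀ i, c i ∈ Submodule.span ℚ (Set.range fun x : E i => fun g : G => antiVec (Φ i) g x)) →
        ∑ i, c i = 0 → ∀ j, c j ∈ Submodule.span ℚ (Set.range fun x₀ : E j => fun g : G =>
          ∑ x ∈ Finset.univ.filter (fun x : E j => ∃ n ∈ N j, n • x₀ = x), antiVec (Φ j) g x)) :
    typeRank G (sigmaType Φ) + Fintype.card I = (∑ i, typeRank G (Φ i)) + 1 ↔
      iSupIndep fun j => Submodule.span ℚ (Set.range fun x₀ : E j => fun g : G =>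
        ∑ x ∈ Finset.univ.filter (fun x : E j => ∃ n ∈ N j, n • x₀ = x), antiVec (Φ j) g x) := by
  haveI : ∀ j : I, Module.Finite ℚ (Submodule.span ℚ (Set.range fun x₀ : E j => fun g : G =>
      ∑ x ∈ Finset.univ.filter (fun x : E j => ∃ n ∈ N j, n • x₀ = x), antiVec (Φ j) g x)) := fun j => by
    haveI := finite_span_coeff (G := G) (Φ j)
    exact Module.Finite.of_injective (Submodule.inclusion (span_orbitSum_le_span_coeff (Φ j) (N j)))
      (Submodule.inclusion_injective _)
  rw [← finrank_iSup_eq_sum_finrank_iff_iSupIndep]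
  have := sum_typeRank_add_one_add_finrank_iSup_eq_of_absorbed h N habs
  omega

/-- **TYPE-FREE CRITERION ON AN ABSORBED LEVEL: all but one slot with `ρ`-stable `N_j`-orbits ⟹
`Hg(∏_i A_i) = ∏_i Hg(A_i)` for every family of CM types** (a single non-zero `F_{j₀}` has nothing to collide with).
[cite: Gordon1999HodgeAVSurvey, §3 Theorem (proof) and 7.5–7.7] [cite: Shimura1998, §8.3] -/
theorem typeRank_sigmaType_add_card_eq_of_absorbed_of_forall_ne_rho_stable {ρ : G} {Φ : ∀ i, Set (E i)}
    (h : ∀ i, IsCMTypeWith ρ (Φ i)) (N : I → Subgroup G)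
    (habs : ∀ c : I → G → ℚ,
      (∀ i, c i ∈ Submodule.span ℚ (Set.range fun x : E i => fun g : G => antiVec (Φ i) g x)) →
        ∑ i, c i = 0 → ∀ j, c j ∈ Submodule.span ℚ (Set.range fun x₀ : E j => fun g : G =>
          ∑ x ∈ Finset.univ.filter (fun x : E j => ∃ n ∈ N j, n • x₀ = x), antiVec (Φ j) g x))
    (j₀ : I) (hρ : ∀ j : I, j ≠ j₀ → ∀ x₀ : E j, ∃ n ∈ N j, n • x₀ = ρ • x₀) :
    typeRank G (sigmaType Φ) + Fintype.card I = (∑ i, typeRank G (Φ i)) + 1 := by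
  have hmain := sum_typeRank_add_one_add_finrank_iSup_eq_of_absorbed h N habs
  have h0 : ∀ j : I, j ≠ j₀ → Submodule.span ℚ (Set.range fun x₀ : E j => fun g : G =>
      ∑ x ∈ Finset.univ.filter (fun x : E j => ∃ n ∈ N j, n • x₀ = x), antiVec (Φ j) g x) =
      (⊥ : Submodule ℚ (G → ℚ)) := fun j hj => span_orbitSum_eq_bot_of_orbit_rho_stable (h j) (N j) (hρ j hj)
  have hsup : (⨆ j, Submodule.span ℚ (Set.range fun x₀ : E j => fun g : G =>
      ∑ x ∈ Finset.univ.filter (fun x : E j => ∃ n ∈ N j, n • x₀ = x), antiVec (Φ j) g x) :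
        Submodule ℚ (G → ℚ)) =
      Submodule.span ℚ (Set.range fun x₀ : E j₀ => fun g : G =>
        ∑ x ∈ Finset.univ.filter (fun x : E j₀ => ∃ n ∈ N j₀, n • x₀ = x), antiVec (Φ j₀) g x) := by
    refine le_antisymm (iSup_le fun j => ?_) (le_iSup (fun j => Submodule.span ℚ (Set.range fun x₀ : E j =>
      fun g : G => ∑ x ∈ Finset.univ.filter (fun x : E j => ∃ n ∈ N j, n • x₀ = x), antiVec (Φ j) g x)) j₀)
    by_cases hj : j = j₀
    · subst hj
      exact le_rfl
    · rw [h0 j hj]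
      exact bot_le
  have hsum : (∑ j, Module.finrank ℚ (Submodule.span ℚ (Set.range fun x₀ : E j => fun g : G =>
      ∑ x ∈ Finset.univ.filter (fun x : E j => ∃ n ∈ N j, n • x₀ = x), antiVec (Φ j) g x))) =
      Module.finrank ℚ (Submodule.span ℚ (Set.range fun x₀ : E j₀ => fun g : G =>
        ∑ x ∈ Finset.univ.filter (fun x : E j₀ => ∃ n ∈ N j₀, n • x₀ = x), antiVec (Φ j₀) g x)) := by
    rw [Finset.sum_eq_single j₀ (fun j _ hj => by rw [h0 j hj, finrank_bot])
      (fun hj => (hj (Finset.mem_univ _)).elim)]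
  rw [hsup, hsum] at hmain
  omega

end Absorbed

end Summit.HodgeConjecture.CorCM.IrrOdd

end
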